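import Summits.QuantumFields.YangMills.Theorems.BalabanUVNodesN15TwoGridCellMean
import Summits.QuantumFields.YangMills.Theorems.BalabanUVNodesN15TwoGridEntry2Smooth
import HarnessLib

/-!
# N15 (NE2) — PROGRAMME K, part K-E: THE CELL-OSCILLATION ROW OF THE GRADIENT OF BAŁABAN's FULL LANDAU-GAUGE PROPAGATOR `Δ_a⁻¹` IN (sup → L²-BLOCK) CURRENCY, HYPOTHESIS-FREE —
# `(∇′_νG′)∘𝔇(M_{c′}, M_{blockAvg c′}) ≤ C·r·(L^k)⁻¹·e^{−δ|y−y′|_T}` measured in the L²-block norm of the output, UNIFORM in the refinement `m`, NO letter on `∇c′`, NO level decomposition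

WHO ∕ WHEN.  Cell `pub-ymgap`, seat `pub-ymgap-dag-n15-a` (KNIT-BY-NAME seat of Track-A DAG node N15 = NE2, g25); `--kind proof --supports stmt-QuantumFields-27366 --as helper` (K3⁸;
count-neutral).  THEOREMS ONLY (0 `def`).  Over this seat's M-A∕M-B∕M-C (`mulOp_comp_pull_eq_neg_divAdj_of_lineMean`, `abs_linePrim_le`, `hasMaj_mulOp_comp_pull`, `lineMean_sweepPiece`,
`abs_sweepPiece_le`, `sum_sweepPiece`, `cellSweep_succ_of_le`, `cellRatio_eq`, `sum_mul_diagK_const`, `cellSweep_eq_pull_blockAvg`), part 61 (`BlockNorm.l2Blocks`, `HasMaj.to_l2Blocks`,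
`κ_l2Blocks`), part 62 (★ `hasMajL2_entries114_pair`: Bałaban's (1.114) entry «∇G∇*J» in L²-block currency for BOTH members of the η-pair of record), part 68 (`etaPow_mul_card_fineBond`) BY NAME;
nothing in the tree is modified.

WHY (HANDOFF §g24.3 (v), (S3); K-C's «located»).  Under the (3.35) pair alone the `c′`-defect behind the front `∇′G′` must be paid through the DIVERGENCE rows `(∇′G′)∘N′∇′*_κ` (M-B's
mechanism); in SUP-block currency the row of the mixed operator «∇G∇*» is `≍ log n′` (near field), NOT uniform in the refinement — whence the King rung's LEVEL SPLIT (dag-n15-d (S1′)) and the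
located item (S3) «level decomposition ∕ kernel profiles of `Δ_a⁻¹`» for the pair of record.  OBSERVATION typed here: in Bałaban's own L²-BLOCK currency the mixed row IS uniformly bounded —
it is the printed (1.114) entry «‖ζ∇GΔ*J‖» (part 62 `hasMajL2_gradDivAdj_of_ineq`, hypothesis-free through `prop12_famG_printed`) — and M-B's mechanism is currency-agnostic in its target.
So the ninth row of III-B EXISTS FOR THE PAIR OF RECORD in (coarse sup-block → fine L²-block) currency with the FULL rate factor `L^{−k}` and NO level decomposition; what remains located is
ONLY the currency upgrade (an L²-target edition of n15-b's jet device + the sub-box interpolation of parts 70∕71 for the dressed gradient's output) — (S3) is thereby REDUCED, not closed.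

WHAT.  §7 `hasMaj_mulOp_comp_pull_l2` (`M_g∘P : coarse sup-blocks → fine L²-blocks ≤ √(d+1)·ω·𝟙`), ★ `hasMaj_comp_mulOp_pull_of_lineMean_zero_l2`, ★★ `hasMaj_comp_mulOp_sub_cellSweep_pull_l2`,
★★ `hasMaj_comp_idef_mulOp_blockAvg_of_divAdj_l2` (M-B∕M-C with the divergence rows read from the fine L²-BLOCK norm: `T′∘ρ′(n′(s_κ⁻¹−1)) ≤ K` on `l2Blocks` ⟹
`T′∘𝔇(M_{c′}, M_{blockAvg c′}) ≤ 2(d+1)√(d+1)·r·(L^k)⁻¹·K` from coarse sup-blocks).  §8 ★★★ `hasMajL2_gGrad_comp_idef_mulOp_blockAvg`: for Bałaban's pair on the torus family of record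
(`M_μ = 2L^{m_T}`, `n = L^k`, `n′ = L^m·L^k`, odd `L`, `a > 0`): `∃ δ C > 0, ∀ m_T k m (1 ≤ k) ν c′ r, |c′| ≤ r ⟹ HasMaj (ofBlocks (unitTorusGeo L k M) (blkFine L k M))
(l2Blocks (unitTorusGeo L k M) (blockOf (L^m·L^k) M ∘ fst) η′^{d+1}) ((ρ′(sD′_ν)∘Δ′_a⁻¹)∘𝔇_{kingPrV}(M_{c′}, M_{blockAvg c′})) (C·r·(L^k)⁻¹·e^{−δ|y−y′|_T})` — HYPOTHESIS-FREE, uniform in `m`.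

HONEST FRAMING ∕ LIMITS.  Finite-lattice bookkeeping + Bałaban's (1.114) by name at `U ≡ 1` on the torus family of record; the OUTPUT is measured in the L²-block norm (NOT the sup-block norm
III-B consumes) — the dressed-gradient entry of the pair of record is NOT obtained here; abelianised scalar multipliers; NE2⁺ NOT printed ∕ NOT proved; no statement of record touched; N15 NOT
discharged; K3⁸ OPEN; counts UNMOVED (typed 28∕28 · discharged 5∕27); one finite torus per index — NOT ℝ⁴ ∕ infinite volume ∕ OS ∕ mass gap ∕ Clay.
-/

noncomputable section

open scoped BigOperators
open Finset

namespace Summit.QuantumFields.YangMills.BalabanUVNodes.N15.TwoGrid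

open Literature.MathematicalPhysics.QuantumFieldTheory.Balaban1983to89
open Literature.MathematicalPhysics.QuantumFieldTheory.Balaban1983to89.B11SectG (BlockNorm HasMaj hasMaj_comp hasMaj_sum)
open Literature.MathematicalPhysics.QuantumFieldTheory.Balaban1983to89.T4EtaRateDefect (idef idef_apply)
open Literature.MathematicalPhysics.QuantumFieldTheory.Balaban1983to89.T4EtaRateCoeffDefect (pull pull_apply diagK blockAvg idef_mulOp_eq)
open Literature.MathematicalPhysics.QuantumFieldTheory.Balaban1983to89.B6Prop26Gluing (mulOp mulOp_apply)
open Literature.MathematicalPhysics.QuantumFieldTheory.Balaban1983to89.B5Prop11Plancherel (Tor fine unitVec)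
open Literature.MathematicalPhysics.QuantumFieldTheory.Balaban1983to89.B5SiteBridgeP12 (MP)
open Literature.MathematicalPhysics.QuantumFieldTheory.Balaban1983to89.B5SettingP12Weighted (etaPow etaPow_nonneg)
open Literature.MathematicalPhysics.QuantumFieldTheory.King1986.Torus (blockOf tdistT tdistT_nonneg)
open Literature.MathematicalPhysics.QuantumFieldTheory.Balaban1983to89.B6UnitTorusCarrier (unitTorusGeo)
open Summit.QuantumFields.YangMills.BalabanUVNodes.N15.VectorPiece (kingPrV blkFine blkFine_comp_kingPrV)

variable {d : ℕ}

/-! ## §7 M-B ∕ M-C with the divergence rows read from the fine L²-block norm -/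

section L2Rows

variable {L : ℕ} [NeZero L] (M : Fin (d + 1) → ℕ) [∀ μ, NeZero (M μ)] (k m : ℕ) {F₂ : Type} [AddCommGroup F₂] [Module ℝ F₂]

/-- `M_g∘P` from King's coarse sup-blocks to the fine L²-BLOCKS (weight `η′^{d+1}`): `≤ √(d+1)·ω·𝟙[y = y′]` for `|g| ≤ ω` (M-B `hasMaj_mulOp_comp_pull` + part 61 `HasMaj.to_l2Blocks`;
`η′^{d+1}·#block = d + 1`). [folklore] [cite: Balaban1984PropagatorsII, (2.150) p.249 (bonds of a block)] -/
theorem hasMaj_mulOp_comp_pull_l2 {g : Tor (fine (L ^ m * L ^ k) M) × Fin (d + 1) → ℝ} {ω : ℝ} (hω : 0 ≤ ω) (hg : ∀ z, |g z| ≤ ω) :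
    HasMaj (BlockNorm.ofBlocks (unitTorusGeo L k M) (blkFine L k M))
      (BlockNorm.l2Blocks (unitTorusGeo L k M) (fun i : Tor (fine (L ^ m * L ^ k) M) × Fin (d + 1) => blockOf (L ^ m * L ^ k) M i.1) (etaPow (L ^ m * L ^ k) (d + 1)) (etaPow_nonneg _ _))
      (mulOp g ∘ₗ pull (kingPrV L k m M)) (fun y y' => Real.sqrt ((d : ℝ) + 1) * diagK (g := unitTorusGeo L k M) (fun _ => ω) y y') :=
  HasMaj.to_l2Blocks (g := unitTorusGeo L k M) (blk := fun i : Tor (fine (L ^ m * L ^ k) M) × Fin (d + 1) => blockOf (L ^ m * L ^ k) M i.1) (w := etaPow (L ^ m * L ^ k) (d + 1))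
    (etaPow_nonneg _ _) (fun y => (etaPow_mul_card_fineBond M (L ^ m * L ^ k) y).le) (hasMaj_mulOp_comp_pull M k m hω hg)

/-- ★ **A LINE-MEAN-ZERO MULTIPLIER BEHIND AN L²-BOUNDED SOURCE-DIVERGENCE LETTER COSTS ONE RATE FACTOR**: `lineMean_κ g = 0`, `|g| ≤ ω`, `T′∘ρ′(n′(s_κ⁻¹ − 1)) ≤ K` FROM THE FINE L²-BLOCK NORM
(Bałaban's (1.114) currency) ⟹ `T′∘(M_g∘P) ≤ √(d+1)·((L^m∕n′)·ω)·K` from King's coarse sup-blocks.  M-B's proof verbatim, the middle norm being `l2Blocks` (`κ = 1`).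
[cite: Balaban1984PropagatorsI, Prop. 1.2 (1.114) p.36 (the letter «‖ζ∇GΔ*J‖», shape); King1986, Prop. 3.9 (3.73) p.665 (rate factor)] -/
theorem hasMaj_comp_mulOp_pull_of_lineMean_zero_l2 {b₂ : BlockNorm (unitTorusGeo L k M) F₂} {T' : (Tor (fine (L ^ m * L ^ k) M) × Fin (d + 1) → ℝ) →ₗ[ℝ] F₂}
    {K : Tor M → Tor M → ℝ} (hK : ∀ y y', 0 ≤ K y y') (κ : Fin (d + 1)) {g : Tor (fine (L ^ m * L ^ k) M) × Fin (d + 1) → ℝ} {ω : ℝ} (hω : 0 ≤ ω)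
    (hg0 : lineMean M (L ^ m * L ^ k) (L ^ m) κ g = 0) (hg : ∀ z, |g z| ≤ ω)
    (hT : HasMaj (BlockNorm.l2Blocks (unitTorusGeo L k M) (fun i : Tor (fine (L ^ m * L ^ k) M) × Fin (d + 1) => blockOf (L ^ m * L ^ k) M i.1) (etaPow (L ^ m * L ^ k) (d + 1)) (etaPow_nonneg _ _))
      b₂ (T' ∘ₗ symbOp M (L ^ m * L ^ k) (((L ^ m * L ^ k : ℕ) : ℝ) • (sTinv M (L ^ m * L ^ k) κ - 1))) K) :
    HasMaj (BlockNorm.ofBlocks (unitTorusGeo L k M) (blkFine L k M)) b₂ (T' ∘ₗ (mulOp g ∘ₗ pull (kingPrV L k m M)))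
      (fun y y' => Real.sqrt ((d : ℝ) + 1) * (((L ^ m : ℕ) : ℝ) / ((L ^ m * L ^ k : ℕ) : ℝ) * ω) * K y y') := by
  have hℓ0 : 0 < L ^ m := pow_pos (Nat.pos_of_ne_zero (NeZero.ne L)) m
  have hid : T' ∘ₗ (mulOp g ∘ₗ pull (kingPrV L k m M)) =
      -((T' ∘ₗ symbOp M (L ^ m * L ^ k) (((L ^ m * L ^ k : ℕ) : ℝ) • (sTinv M (L ^ m * L ^ k) κ - 1))) ∘ₗ
        (mulOp (linePrim M (L ^ m * L ^ k) (L ^ m) κ g) ∘ₗ pull (kingPrV L k m M))) := by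
    rw [mulOp_comp_pull_eq_neg_divAdj_of_lineMean M L k m κ hg0, LinearMap.comp_neg, LinearMap.comp_assoc]
  have hprim : ∀ z, |linePrim M (L ^ m * L ^ k) (L ^ m) κ g z| ≤ ((L ^ m : ℕ) : ℝ) / ((L ^ m * L ^ k : ℕ) : ℝ) * ω := fun z =>
    abs_linePrim_le M (L ^ m * L ^ k) hℓ0 κ hω fun j _ => hg _
  have hω' : 0 ≤ ((L ^ m : ℕ) : ℝ) / ((L ^ m * L ^ k : ℕ) : ℝ) * ω := mul_nonneg (by positivity) hω
  have hM := hasMaj_mulOp_comp_pull_l2 M k m hω' hprim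
  rw [hid]
  refine ((hasMaj_comp hT hM hK).mono fun y y' => le_of_eq ?_).neg
  show ∑ y'' : Tor M, K y y'' * ((BlockNorm.l2Blocks (unitTorusGeo L k M) (fun i : Tor (fine (L ^ m * L ^ k) M) × Fin (d + 1) => blockOf (L ^ m * L ^ k) M i.1)
      (etaPow (L ^ m * L ^ k) (d + 1)) (etaPow_nonneg _ _)).κ * (Real.sqrt ((d : ℝ) + 1) *
        diagK (g := unitTorusGeo L k M) (fun _ => ((L ^ m : ℕ) : ℝ) / ((L ^ m * L ^ k : ℕ) : ℝ) * ω) y'' y')) = _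
  rw [κ_l2Blocks]
  simp only [one_mul, ← mul_assoc]
  rw [show ∑ y'' : Tor M, K y y'' * Real.sqrt ((d : ℝ) + 1) * diagK (g := unitTorusGeo L k M) (fun _ => ((L ^ m : ℕ) : ℝ) / ((L ^ m * L ^ k : ℕ) : ℝ) * ω) y'' y'
      = ∑ y'' : Tor M, (K y y'' * Real.sqrt ((d : ℝ) + 1)) * diagK (g := unitTorusGeo L k M) (fun _ => ((L ^ m : ℕ) : ℝ) / ((L ^ m * L ^ k : ℕ) : ℝ) * ω) y'' y' from rfl,
    sum_mul_diagK_const]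
  ring

/-- ★★ **THE CELL-OSCILLATING PART OF ANY BOUNDED MULTIPLIER BEHIND L²-BOUNDED SOURCE-DIVERGENCE LETTERS COSTS ONE RATE FACTOR** (M-B in L²-row currency): `|w| ≤ ω`,
`T′∘ρ′(n′(s_κ⁻¹ − 1)) ≤ K` from the fine L²-blocks for every `κ` ⟹ `T′∘(M_{w − cellSweep (d+1) w}∘P) ≤ 2(d+1)√(d+1)·ω·(L^k)⁻¹·K` from King's coarse sup-blocks.
[cite: Balaban1984PropagatorsI, Prop. 1.2 (1.114) p.36 (shape); King1986, Prop. 3.9 (3.73) p.665 (rate factor L^{−k})] -/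
theorem hasMaj_comp_mulOp_sub_cellSweep_pull_l2 {b₂ : BlockNorm (unitTorusGeo L k M) F₂} {T' : (Tor (fine (L ^ m * L ^ k) M) × Fin (d + 1) → ℝ) →ₗ[ℝ] F₂}
    {K : Tor M → Tor M → ℝ} (hK : ∀ y y', 0 ≤ K y y') {w : Tor (fine (L ^ m * L ^ k) M) × Fin (d + 1) → ℝ} {ω : ℝ} (hω : 0 ≤ ω) (hw : ∀ z, |w z| ≤ ω)
    (hT : ∀ κ : Fin (d + 1), HasMaj (BlockNorm.l2Blocks (unitTorusGeo L k M) (fun i : Tor (fine (L ^ m * L ^ k) M) × Fin (d + 1) => blockOf (L ^ m * L ^ k) M i.1)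
        (etaPow (L ^ m * L ^ k) (d + 1)) (etaPow_nonneg _ _)) b₂
      (T' ∘ₗ symbOp M (L ^ m * L ^ k) (((L ^ m * L ^ k : ℕ) : ℝ) • (sTinv M (L ^ m * L ^ k) κ - 1))) K) :
    HasMaj (BlockNorm.ofBlocks (unitTorusGeo L k M) (blkFine L k M)) b₂
      (T' ∘ₗ (mulOp (w - cellSweep M (L ^ m * L ^ k) (L ^ m) (d + 1) w) ∘ₗ pull (kingPrV L k m M)))
      (fun y y' => 2 * (d + 1) * Real.sqrt ((d : ℝ) + 1) * ω * (((L ^ k : ℕ) : ℝ))⁻¹ * K y y') := by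
  have hℓ0 : 0 < L ^ m := pow_pos (Nat.pos_of_ne_zero (NeZero.ne L)) m
  have hℓn : L ^ m ∣ L ^ m * L ^ k := Dvd.intro _ rfl
  set p : ℕ → (Tor (fine (L ^ m * L ^ k) M) × Fin (d + 1) → ℝ) := fun j => cellSweep M (L ^ m * L ^ k) (L ^ m) j w - cellSweep M (L ^ m * L ^ k) (L ^ m) (j + 1) w with hp
  have hsum : T' ∘ₗ (mulOp (w - cellSweep M (L ^ m * L ^ k) (L ^ m) (d + 1) w) ∘ₗ pull (kingPrV L k m M)) =
      ∑ j ∈ range (d + 1), T' ∘ₗ (mulOp (p j) ∘ₗ pull (kingPrV L k m M)) := by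
    refine LinearMap.ext fun φ => ?_
    rw [LinearMap.sum_apply, LinearMap.comp_apply]
    simp only [LinearMap.comp_apply]
    rw [← map_sum]
    congr 1
    funext z
    rw [Finset.sum_apply, mulOp_apply, pull_apply]
    simp only [mulOp_apply, pull_apply, ← Finset.sum_mul]
    rw [← Finset.sum_apply, sum_sweepPiece]
  rw [hsum]
  have hpiece : ∀ j, HasMaj (BlockNorm.ofBlocks (unitTorusGeo L k M) (blkFine L k M)) b₂ (T' ∘ₗ (mulOp (p j) ∘ₗ pull (kingPrV L k m M)))
      (fun y y' => if j < d + 1 then Real.sqrt ((d : ℝ) + 1) * (((L ^ m : ℕ) : ℝ) / ((L ^ m * L ^ k : ℕ) : ℝ) * (2 * ω)) * K y y' else 0) := by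
    intro j
    by_cases hj : j < d + 1
    · simp only [if_pos hj]
      exact hasMaj_comp_mulOp_pull_of_lineMean_zero_l2 M k m hK ⟨j, hj⟩ (by positivity) (lineMean_sweepPiece M _ hℓn hj w) (abs_sweepPiece_le M _ hℓ0 hw j) (hT ⟨j, hj⟩)
    · simp only [if_neg hj]
      have hz : p j = 0 := by
        simp only [hp]
        rw [cellSweep_succ_of_le M _ (not_lt.mp hj), sub_self]
      have h0 : T' ∘ₗ (mulOp (p j) ∘ₗ pull (kingPrV L k m M)) = 0 := by
        refine LinearMap.ext fun φ => ?_
        rw [LinearMap.comp_apply, LinearMap.comp_apply, hz, LinearMap.zero_apply]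
        have : mulOp (0 : Tor (fine (L ^ m * L ^ k) M) × Fin (d + 1) → ℝ) (pull (kingPrV L k m M) φ) = 0 := funext fun z => by rw [mulOp_apply]; simp
        rw [this, map_zero]
      rw [h0]
      exact B11SectG.hasMaj_zero _ _
  refine (hasMaj_sum _ _ hpiece (d + 1)).mono fun y y' => le_of_eq ?_
  rw [Finset.sum_congr rfl fun j hj => if_pos (mem_range.mp hj), sum_const, card_range, nsmul_eq_mul, cellRatio_eq]
  push_cast
  ring

/-- ★★ **THE SANDWICHED `c′`-DEFECT WITH THE BLOCK-AVERAGED COARSE PARTNER, L²-ROW EDITION OF M-C ★★★**: `|c′| ≤ r`, `T′∘ρ′(n′(s_κ⁻¹ − 1)) ≤ K` from the fine L²-blocks for every `κ` ⟹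
`T′∘𝔇_{kingPrV}(M_{c′}, M_{blockAvg c′}) ≤ 2(d+1)√(d+1)·r·(L^k)⁻¹·K` from King's coarse sup-blocks — NO fit ∕ oscillation ∕ gradient letter on `c′`.
[cite: Balaban1985BackgroundPropagators, (3.35) p.396 (the letter «|A| ≤ O(1)Mα₀(L^jη)^{−1}»), (3.52) p.400; Balaban1984PropagatorsI, Prop. 1.2 (1.114) p.36 (shape); King1986, p.664 (pairing)] -/
theorem hasMaj_comp_idef_mulOp_blockAvg_of_divAdj_l2 {b₂ : BlockNorm (unitTorusGeo L k M) F₂} {T' : (Tor (fine (L ^ m * L ^ k) M) × Fin (d + 1) → ℝ) →ₗ[ℝ] F₂}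
    {K : Tor M → Tor M → ℝ} (hK : ∀ y y', 0 ≤ K y y') {c' : Tor (fine (L ^ m * L ^ k) M) × Fin (d + 1) → ℝ} {r : ℝ} (hr : 0 ≤ r) (hc' : ∀ z, |c' z| ≤ r)
    (hT : ∀ κ : Fin (d + 1), HasMaj (BlockNorm.l2Blocks (unitTorusGeo L k M) (fun i : Tor (fine (L ^ m * L ^ k) M) × Fin (d + 1) => blockOf (L ^ m * L ^ k) M i.1)
        (etaPow (L ^ m * L ^ k) (d + 1)) (etaPow_nonneg _ _)) b₂
      (T' ∘ₗ symbOp M (L ^ m * L ^ k) (((L ^ m * L ^ k : ℕ) : ℝ) • (sTinv M (L ^ m * L ^ k) κ - 1))) K) :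
    HasMaj (BlockNorm.ofBlocks (unitTorusGeo L k M) (blkFine L k M)) b₂
      (T' ∘ₗ idef (pull (kingPrV L k m M)) (pull (kingPrV L k m M)) (mulOp c') (mulOp (blockAvg (kingPrV L k m M) c')))
      (fun y y' => 2 * (d + 1) * Real.sqrt ((d : ℝ) + 1) * r * (((L ^ k : ℕ) : ℝ))⁻¹ * K y y') := by
  have hid : idef (pull (kingPrV L k m M)) (pull (kingPrV L k m M)) (mulOp c') (mulOp (blockAvg (kingPrV L k m M) c')) =
      mulOp (c' - cellSweep M (L ^ m * L ^ k) (L ^ m) (d + 1) c') ∘ₗ pull (kingPrV L k m M) := by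
    rw [idef_mulOp_eq, cellSweep_eq_pull_blockAvg]
    rfl
  rw [hid]
  exact hasMaj_comp_mulOp_sub_cellSweep_pull_l2 M k m hK hr hc' hT

end L2Rows

/-! ## §8 ★★★ Hypothesis-free for Bałaban's full Landau-gauge propagator on the torus family of record -/

section Balaban

variable (d) {L : ℕ} [NeZero L]

/-- ★★★ **THE CELL-OSCILLATION ROW OF `∇′_νΔ′_a⁻¹` IN (sup → L²-BLOCK) CURRENCY, HYPOTHESIS-FREE, UNIFORM IN THE REFINEMENT, NO LETTER ON `∇c′`, NO LEVEL DECOMPOSITION.**  For odd `L > 1`,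
`a > 0` there are `δ, C > 0` such that for every torus `M_μ = 2L^{m_T}`, coarse level `k ≥ 1`, refinement `m`, direction `ν` and every fine multiplier `|c′| ≤ r` (`0 ≤ r`):
`HasMaj (ofBlocks (unitTorusGeo L k M) (blkFine L k M)) (l2Blocks (unitTorusGeo L k M) (blockOf (L^m·L^k) M ∘ fst) η′^{d+1}) ((ρ′(sD′_ν n′)∘Δ′_a⁻¹)∘𝔇_{kingPrV}(M_{c′}, M_{blockAvg c′}))
(C·r·(L^k)⁻¹·e^{−δ|y−y′|_T})`.  The divergence rows are Bałaban's printed (1.114) entry «∇GΔ*» (part 62, `U ≡ 1`), bounded in L²-block currency where the sup-block row is `≍ log n′`.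
This is III-B's ninth row for the PAIR OF RECORD up to the currency of the output (L²-block instead of sup-block) — the located item (S3) reduced to a currency upgrade.
[cite: Balaban1984PropagatorsI, Prop. 1.2 (1.114) p.36 (‖ζ∇GΔ*J‖); Balaban1985BackgroundPropagators, (3.35) p.396, (3.52) p.400, Thm 3.1 (3.42) p.397 (second entry: the row's consumer); King1986,
p.664 (pairing), Prop. 3.9 (3.73) p.665 (rate factor)] -/
theorem hasMajL2_gGrad_comp_idef_mulOp_blockAvg (hL : Odd L ∧ 1 < L) {a : ℝ} (ha : 0 < a) :
    ∃ δ C : ℝ, 0 < δ ∧ 0 < C ∧ ∀ (mT k m : ℕ) (hk : 1 ≤ k) (ν : Fin (d + 1)) (c' : Tor (fine (L ^ m * L ^ k) (MP (paramsOf d L mT k hL))) × Fin (d + 1) → ℝ) (r : ℝ),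
      0 ≤ r → (∀ z, |c' z| ≤ r) →
      HasMaj (BlockNorm.ofBlocks (unitTorusGeo L k (MP (paramsOf d L mT k hL))) (blkFine L k (MP (paramsOf d L mT k hL))))
        (BlockNorm.l2Blocks (unitTorusGeo L k (MP (paramsOf d L mT k hL)))
          (fun i : Tor (fine (L ^ m * L ^ k) (MP (paramsOf d L mT k hL))) × Fin (d + 1) => blockOf (L ^ m * L ^ k) (MP (paramsOf d L mT k hL)) i.1)
          (etaPow (L ^ m * L ^ k) (d + 1)) (etaPow_nonneg _ _))
        ((symbOp (MP (paramsOf d L mT k hL)) (L ^ m * L ^ k) (sD (MP (paramsOf d L mT k hL)) (L ^ m * L ^ k) ν (L ^ m * L ^ k : ℕ)) ∘ₗ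
            gOp (MP (paramsOf d L mT k hL)) (L ^ m * L ^ k) a) ∘ₗ
          idef (pull (kingPrV L k m (MP (paramsOf d L mT k hL)))) (pull (kingPrV L k m (MP (paramsOf d L mT k hL))))
            (mulOp c') (mulOp (blockAvg (kingPrV L k m (MP (paramsOf d L mT k hL))) c')))
        (fun y y' => C * r * (((L ^ k : ℕ) : ℝ))⁻¹ * Real.exp (-(δ * tdistT (MP (paramsOf d L mT k hL)) y y'))) := by
  obtain ⟨δ₀, C, hδ₀, hC, H⟩ := hasMajL2_entries114_pair (d := d) hL ha
  refine ⟨δ₀, 2 * ((d : ℝ) + 1) * Real.sqrt ((d : ℝ) + 1) * C, hδ₀, by positivity, fun mT k m hk ν c' r hr hc' => ?_⟩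
  have hmem : L ^ m * L ^ k ∈ ({L ^ k, L ^ m * L ^ k} : Finset ℕ) := by simp
  have hT : ∀ κ : Fin (d + 1), HasMaj
      (BlockNorm.l2Blocks (unitTorusGeo L k (MP (paramsOf d L mT k hL)))
        (fun i : Tor (fine (L ^ m * L ^ k) (MP (paramsOf d L mT k hL))) × Fin (d + 1) => blockOf (L ^ m * L ^ k) (MP (paramsOf d L mT k hL)) i.1)
        (etaPow (L ^ m * L ^ k) (d + 1)) (etaPow_nonneg _ _))
      (BlockNorm.l2Blocks (unitTorusGeo L k (MP (paramsOf d L mT k hL)))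
        (fun i : Tor (fine (L ^ m * L ^ k) (MP (paramsOf d L mT k hL))) × Fin (d + 1) => blockOf (L ^ m * L ^ k) (MP (paramsOf d L mT k hL)) i.1)
        (etaPow (L ^ m * L ^ k) (d + 1)) (etaPow_nonneg _ _))
      ((symbOp (MP (paramsOf d L mT k hL)) (L ^ m * L ^ k) (sD (MP (paramsOf d L mT k hL)) (L ^ m * L ^ k) ν (L ^ m * L ^ k : ℕ)) ∘ₗ
          gOp (MP (paramsOf d L mT k hL)) (L ^ m * L ^ k) a) ∘ₗ
        symbOp (MP (paramsOf d L mT k hL)) (L ^ m * L ^ k) (((L ^ m * L ^ k : ℕ) : ℝ) • (sTinv (MP (paramsOf d L mT k hL)) (L ^ m * L ^ k) κ - 1)))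
      (fun y y' => C * Real.exp (-(δ₀ * tdistT (MP (paramsOf d L mT k hL)) y y'))) := fun κ => by
    rw [LinearMap.comp_assoc]
    exact (H mT k m hk ν κ (L ^ m * L ^ k) hmem inferInstance).2.1
  refine (hasMaj_comp_idef_mulOp_blockAvg_of_divAdj_l2 (MP (paramsOf d L mT k hL)) k m (fun y y' => mul_nonneg hC.le (Real.exp_nonneg _)) hr hc' hT).mono
    fun y y' => le_of_eq ?_
  ring

end Balaban

end Summit.QuantumFields.YangMills.BalabanUVNodes.N15.TwoGrid

end
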